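import Mathlib.Data.Set.Card
import Mathlib.Tactic.Abel
import Mathlib.Algebra.Group.Units.Equiv
import Literature.IUT.HodgeArakelov.ThetaValueOrbits
import Literature.IUT.HodgeArakelov.BadPrimeGaussianMonoids

/-!
# [IUTchII] Cor 2.8 (i) output ⟹ Cor 3.5 (ii) input: theta-value orbits are value-profile data (bridge)

Merge bridge inside layer L6 (abc-iut cell; no re-typing of landed modules). S. Mochizuki,
*Inter-universal Teichmüller theory II*, kurims Dec-2020 manuscript:

* Cor 2.8 (i) p. 82 (typed in `ThetaValueOrbits.lean`, p404347): the mono-theta-theoretic evaluation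
  yields, at each label `t ∈ LabCusp^±`, "`μ_{2l}`-orbits of elements `θ^t_env ⊆ ∞θ^t_env ⊆
  lim H¹(G_v(…), Π_μ(…))`" which "depend only on the label `|t| ∈ |F_l|`" — output record
  `ThetaValueOrbits.MonoThetaEvaluationData` (additive cohomology module `HG`, `thetaT t = mu2lOrbit 2l η_t`,
  `thetaAbs |t|`);
* Cor 3.5 (i)–(ii) p. 94 (typed in `BadPrimeGaussianMonoids.lean`, p404298): "by applying the Kummer
  structures … to the restriction isomorphisms …, mono-theta-theoretic theta values
  `θ^{|t|}_env(M^Θ_*) ⊆ Ψ_cns(M^Θ_*)_{|t|}`", and "an element of the set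
  `θ^{F_l^⋇}_env := ∏_{|t| ∈ F_l^⋇} θ^{|t|}_env` — which is of cardinality `(2l)^{l⋇}` — [is] a value-profile"
  — input record `ValueProfileData T M 2l` (multiplicative monoid `M`, a `Finset` of exactly `2l` values
  at each label forming one orbit under `2l`-th roots of unity).

This file supplies the map from the former to the latter:

* `ValueProfileData.ofOrbits` — for an additive module `HG` whose `2l`-torsion has exactly `2l`
  elements (as for `H¹(G_v, Π_μ) ⊇` the Kummer image of `K_v^× ∋ μ_{2l}`), a family of `μ_{2l}`-orbits
  `|t| ↦ η_{|t|} + HG[2l]` IS value-profile data in `M := Multiplicative HG`;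
* `ValueProfileData.ofMonoThetaEvaluationData` — applied to the Cor 2.8 (i) output `thetaAbs` along a
  labelling `lab : T → |F_l|` (e.g. the inclusion `F_l^⋇ ⊆ |F_l|`);
* `ValueProfileData.map` — transport of value-profile data along an isomorphism of monoids (the
  "Kummer structures / restriction isomorphisms" of Cor 3.5 (i) are such isomorphisms on the relevant
  submonoids); hence `card_valueProfiles` of `BadPrimeGaussianMonoids` gives the printed count
  `(2l)^{l⋇}` for the Cor 2.8 output (`card_valueProfiles_ofMonoThetaEvaluationData`).

Claim key `Mochizuki2012` DISPUTED (D-0012): elementary bookkeeping between two typed interfaces; nothing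
here asserts a disputed claim or takes a side on [IUTchIII] Cor 3.12.
-/

namespace Literature.IUT.HodgeArakelov

open ThetaValueOrbits

universe u v w

/-! ### 1. Transport of value-profile data along an isomorphism of monoids (Cor 3.5 (i)) -/

section Map

variable {T : Type u} {M : Type v} {M' : Type w} [CommMonoid M] [CommMonoid M'] {twoL : ℕ}

/-- Transport of value-profile data along an isomorphism of monoids `M ⥲ M'` — the shape of "by
applying the Kummer structures … to the restriction isomorphisms … of (i)" ([IUTchII] Cor 3.5 (i)–(ii)
p. 94: the theta values are carried into `Ψ_cns(M^Θ_*)_{|t|}` along isomorphisms).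
[cite: Mochizuki2012, Cor 3.5 (i) p.94] -/
def ValueProfileData.map (D : ValueProfileData T M twoL) (e : M ≃* M') : ValueProfileData T M' twoL where
  thetaValues t := (D.thetaValues t).map e.toEquiv.toEmbedding
  card_thetaValues t := by rw [Finset.card_map, D.card_thetaValues]
  orbit t a ha b hb := by
    rw [Finset.mem_map] at ha hb
    obtain ⟨a₀, ha₀, rfl⟩ := ha
    obtain ⟨b₀, hb₀, rfl⟩ := hb
    obtain ⟨ζ, hζ, hab⟩ := D.orbit t a₀ ha₀ b₀ hb₀
    refine ⟨Units.map e.toMonoidHom ζ, ?_, ?_⟩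
    · rw [← map_pow, hζ, map_one]
    · change e a₀ = (e (ζ : M)) * e b₀
      rw [hab, map_mul]

/-- The transported values at a label are the images of the original ones. [cite: Mochizuki2012, Cor 3.5 (i) p.94] -/
theorem ValueProfileData.mem_map_thetaValues (D : ValueProfileData T M twoL) (e : M ≃* M') (t : T)
    (x : M') : x ∈ (D.map e).thetaValues t ↔ e.symm x ∈ D.thetaValues t := by
  change x ∈ (D.thetaValues t).map e.toEquiv.toEmbedding ↔ _
  rw [Finset.mem_map_equiv]
  rfl

end Map

/-! ### 2. `μ_{2l}`-orbits in an additive module with exactly `2l` elements of `2l`-torsion -/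

section Orbits

variable {HG : Type v} [AddCommGroup HG] (twoL : ℕ)

/-- The `2l`-torsion `HG[2l] = {τ | 2l·τ = 0}` of the (additively written) cohomology module — the
Kummer classes of `μ_{2l}` ([IUTchII] Cor 2.8 (i) p. 82 "`μ_{2l}`-orbits"). [cite: Mochizuki2012, Cor 2.8 (i) p.82] -/
def torsionTwoL : Set HG := {τ | twoL • τ = 0}

/-- A `μ_{2l}`-orbit is the translate of the `2l`-torsion: `mu2lOrbit 2l η = η + HG[2l]`.
[cite: Mochizuki2012, Cor 2.8 (i) p.82] -/
theorem mu2lOrbit_eq_image (η : HG) : mu2lOrbit twoL η = (fun τ => η + τ) '' torsionTwoL twoL := by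
  ext x
  simp only [mu2lOrbit, torsionTwoL, Set.mem_setOf_eq, Set.mem_image]
  constructor
  · rintro ⟨τ, hτ, rfl⟩; exact ⟨τ, hτ, rfl⟩
  · rintro ⟨τ, hτ, rfl⟩; exact ⟨τ, hτ, rfl⟩

variable {twoL}

/-- If `HG[2l]` has exactly `2l > 0` elements then every `μ_{2l}`-orbit, read in `Multiplicative HG`, is a
finite set … [cite: Mochizuki2012, Cor 2.8 (i) p.82] -/
theorem finite_ofAdd_image_mu2lOrbit (hcard : (torsionTwoL (HG := HG) twoL).ncard = twoL)
    (h0 : 0 < twoL) (η : HG) : (Multiplicative.ofAdd '' mu2lOrbit twoL η).Finite := by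
  have hfin : (torsionTwoL (HG := HG) twoL).Finite :=
    Set.finite_of_ncard_pos (by rw [hcard]; exact h0)
  rw [mu2lOrbit_eq_image]
  exact (hfin.image _).image _

/-- … of exactly `2l` elements ("`μ_{2l}`-orbits of elements", Cor 2.8 (i) p. 82; "of cardinality `(2l)^{l⋇}`"
per profile, Cor 3.5 (ii) p. 94). [cite: Mochizuki2012, Cor 3.5 (ii) p.94] -/
theorem ncard_ofAdd_image_mu2lOrbit (hcard : (torsionTwoL (HG := HG) twoL).ncard = twoL) (η : HG) :
    (Multiplicative.ofAdd '' mu2lOrbit twoL η).ncard = twoL := by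
  rw [Set.ncard_image_of_injective _ Multiplicative.ofAdd.injective, mu2lOrbit_eq_image,
    Set.ncard_image_of_injective _ (add_right_injective η), hcard]

/-- **Value-profile data from a family of `μ_{2l}`-orbits** ([IUTchII] Cor 3.5 (ii) p. 94 over Cor 2.8 (i)
p. 82): in an additive module `HG` whose `2l`-torsion has exactly `2l > 0` elements, a family of orbits
`t ↦ η_t + HG[2l]` gives `ValueProfileData T (Multiplicative HG) 2l` — `2l` values at each label, any two
differing by a `2l`-th root of unity (= a `2l`-torsion class). [cite: Mochizuki2012, Cor 3.5 (ii) p.94] -/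
noncomputable def ValueProfileData.ofOrbits {T : Type u} (hcard : (torsionTwoL (HG := HG) twoL).ncard = twoL)
    (h0 : 0 < twoL) (θ : T → Set HG) (hθ : ∀ t, ∃ η, θ t = mu2lOrbit twoL η) :
    ValueProfileData T (Multiplicative HG) twoL := by
  classical
  exact
  { thetaValues := fun t =>
      (finite_ofAdd_image_mu2lOrbit hcard h0 (Classical.choose (hθ t))).toFinset
    card_thetaValues := fun t => by
      rw [← Set.ncard_eq_toFinset_card _ (finite_ofAdd_image_mu2lOrbit hcard h0 _),
        ncard_ofAdd_image_mu2lOrbit hcard]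
    orbit := fun t a ha b hb => by
      rw [Set.Finite.mem_toFinset] at ha hb
      obtain ⟨a₀, ⟨τ, hτ, rfl⟩, rfl⟩ := ha
      obtain ⟨b₀, ⟨τ', hτ', rfl⟩, rfl⟩ := hb
      refine ⟨toUnits (Multiplicative.ofAdd (τ - τ')), ?_, ?_⟩
      · rw [← map_pow, ← map_one toUnits]
        congr 1
        rw [← ofAdd_nsmul, smul_sub, hτ, hτ', sub_zero, ofAdd_zero]
      · rw [val_toUnits_apply, ← ofAdd_add]
        congr 1
        abel }

/-- The values at `t` of `ofOrbits` are exactly the (multiplicatively read) orbit `θ t`.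
[cite: Mochizuki2012, Cor 3.5 (ii) p.94] -/
theorem ValueProfileData.mem_ofOrbits_thetaValues {T : Type u}
    (hcard : (torsionTwoL (HG := HG) twoL).ncard = twoL) (h0 : 0 < twoL) (θ : T → Set HG)
    (hθ : ∀ t, ∃ η, θ t = mu2lOrbit twoL η) (t : T) (x : Multiplicative HG) :
    x ∈ (ValueProfileData.ofOrbits hcard h0 θ hθ).thetaValues t ↔ Multiplicative.toAdd x ∈ θ t := by
  classical
  change x ∈ (finite_ofAdd_image_mu2lOrbit hcard h0 (Classical.choose (hθ t))).toFinset ↔ _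
  rw [Set.Finite.mem_toFinset, ← Classical.choose_spec (hθ t)]
  constructor
  · rintro ⟨y, hy, rfl⟩; simpa using hy
  · intro hx; exact ⟨Multiplicative.toAdd x, hx, by simp⟩

end Orbits

/-! ### 3. From the Cor 2.8 (i) output record -/

section Cor28

variable {twoL : ℕ} {LabCusp LabAbs : Type u} {abs : LabCusp → LabAbs} {H HG : Type v}
  [AddCommGroup H] [AddCommGroup HG]

/-- **[IUTchII] Cor 2.8 (i) ⟹ Cor 3.5 (ii)**: the orbit-sets `θ^{|t|}_env` of a mono-theta-theoretic theta
evaluation (`MonoThetaEvaluationData`, Cor 2.8 (i) p. 82), at the labels picked out by `lab : T → |F_l|`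
(e.g. `F_l^⋇ ↪ |F_l|`, Cor 3.5 (ii) p. 94 "`∏_{|t| ∈ F_l^⋇}`"), form value-profile data in
`Multiplicative HG` — provided the `2l`-torsion of the cohomology module has exactly `2l > 0` elements.
[cite: Mochizuki2012, Cor 3.5 (ii) p.94] -/
noncomputable def ValueProfileData.ofMonoThetaEvaluationData {T : Type w}
    (D : MonoThetaEvaluationData twoL LabCusp LabAbs abs H HG) (habs : Function.Surjective abs)
    (hcard : (torsionTwoL (HG := HG) twoL).ncard = twoL) (h0 : 0 < twoL) (lab : T → LabAbs) :
    ValueProfileData T (Multiplicative HG) twoL :=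
  ValueProfileData.ofOrbits hcard h0 (fun t => thetaAbs D habs (lab t)) fun t => by
    obtain ⟨η, -, hη⟩ := D.thetaT_isOrbit (Classical.choose (habs (lab t)))
    exact ⟨_, hη⟩

/-- The values at label `t` ARE the Cor 2.8 (i) orbit `θ^{lab t}_env`, read multiplicatively.
[cite: Mochizuki2012, Cor 3.5 (ii) p.94] -/
theorem ValueProfileData.mem_ofMonoThetaEvaluationData {T : Type w}
    (D : MonoThetaEvaluationData twoL LabCusp LabAbs abs H HG) (habs : Function.Surjective abs)
    (hcard : (torsionTwoL (HG := HG) twoL).ncard = twoL) (h0 : 0 < twoL) (lab : T → LabAbs) (t : T)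
    (x : Multiplicative HG) :
    x ∈ (ValueProfileData.ofMonoThetaEvaluationData D habs hcard h0 lab).thetaValues t ↔
      Multiplicative.toAdd x ∈ thetaAbs D habs (lab t) :=
  ValueProfileData.mem_ofOrbits_thetaValues hcard h0 _ _ t x

/-- **Cor 3.5 (ii) p. 94, "of cardinality `(2l)^{l⋇}`", for the Cor 2.8 (i) output**: the value-profiles
built from a mono-theta-theoretic theta evaluation over a finite label set `T` (`|T| = l⋇`) number
`(2l)^{|T|}`. [cite: Mochizuki2012, Cor 3.5 (ii) p.94] -/
theorem card_valueProfiles_ofMonoThetaEvaluationData {T : Type w} [DecidableEq T] [Fintype T]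
    [DecidableEq HG]
    (D : MonoThetaEvaluationData twoL LabCusp LabAbs abs H HG) (habs : Function.Surjective abs)
    (hcard : (torsionTwoL (HG := HG) twoL).ncard = twoL) (h0 : 0 < twoL) (lab : T → LabAbs) :
    (ValueProfileData.ofMonoThetaEvaluationData D habs hcard h0 lab).valueProfiles.card =
      twoL ^ Fintype.card T :=
  ValueProfileData.card_valueProfiles _

end Cor28

end Literature.IUT.HodgeArakelov
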